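import Mathlib
import Summits.AtomisticToContinuum.Crystallization.Theses.SquareWellLayerCake
import Literature.Geometry.DiscreteGeometry.DelaunaySubdivision
import Literature.Geometry.DiscreteGeometry.SolidAngleFraction
import Summits.AtomisticToContinuum.Crystallization.Theorems.SquareWellLayerCakeAveragedTwelveAssemble
import HarnessLib

/-!
# Line `Sketch` (par-five-delaunay-recount) of crux `SquareWellLayerCake.AveragedTwelve`
# (stmt-AtomisticToContinuum-15806): the glue `stub_assembleSep` (skeleton v10)

Second assembly of the line, for the SEPARATED FRAME form of the residual: the ghost frame is now part of a
globally `d`-separated site set `ω ⊇ P` whose ghosts are farther than `diam P + ρ` from `P`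
(`stub_frameSep`), and the residual inequality is consumed on such frames only (`stub_residualSep` form,
itself derived by `stub_gaugeSep` from the `stub_tetGauge` identity and `stub_cellChargeSep`).  Everything else is as in
`ParFiveRecountAssemble` (recount at each real vertex from the two partitions of unity and Girard via
`recount_comb`; near Delaunay neighbours = `ρ`-close points via `near_pair_mem_faces`).
-/

noncomputable section

open scoped BigOperators Classical

namespace Summit.AtomisticToContinuum.Crystallization.Theorems.ParFiveRecountAssembleSep

open Literature.Geometry.DiscreteGeometry
open Summit.AtomisticToContinuum.Crystallization.Theorems.ParFiveRecountAssemble (recount_comb near_pair_mem_faces)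

/-- **The crux for point sets from the separated-frame ingredients.** [folklore] -/
theorem pointset_bound_sep
    (hframe : ∀ (P : Finset (EuclideanSpace ℝ (Fin 3))) (d R : ℝ), 0 < d → (∀ p ∈ P, ∀ q ∈ P, p ≠ q → d ≤ dist p q) → ∃ ω : Finset (EuclideanSpace ℝ (Fin 3)), P ⊆ ω ∧ (∀ a ∈ ω, ∀ b ∈ ω, a ≠ b → d ≤ dist a b) ∧ (∀ g ∈ ω, g ∉ P → ∀ p ∈ P, R < dist g p) ∧ ((↑P : Set (EuclideanSpace ℝ (Fin 3))) ⊆ interior (convexHull ℝ (↑ω : Set (EuclideanSpace ℝ (Fin 3))))))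
    (hVF : ∀ (ω : Finset (EuclideanSpace ℝ (Fin 3))) (K : Geometry.SimplicialComplex ℝ (EuclideanSpace ℝ (Fin 3))), Literature.Geometry.DiscreteGeometry.IsTriangulation (↑ω : Set (EuclideanSpace ℝ (Fin 3))) K → ∀ v ∈ ω, v ∈ interior (convexHull ℝ (↑ω : Set (EuclideanSpace ℝ (Fin 3)))) → ∀ (S : Finset (Finset (EuclideanSpace ℝ (Fin 3)))), (∀ t, t ∈ S ↔ t ∈ K.faces ∧ v ∈ t ∧ t.card = 4) → ∑ t ∈ S, Literature.Geometry.DiscreteGeometry.ballFraction v (Literature.Geometry.DiscreteGeometry.apexCone v (fun w : ↥((t).erase v) => (↑w : EuclideanSpace ℝ (Fin 3)) - v)) = 1)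
    (hEF : ∀ (ω : Finset (EuclideanSpace ℝ (Fin 3))) (K : Geometry.SimplicialComplex ℝ (EuclideanSpace ℝ (Fin 3))), Literature.Geometry.DiscreteGeometry.IsTriangulation (↑ω : Set (EuclideanSpace ℝ (Fin 3))) K → ∀ v ∈ ω, v ∈ interior (convexHull ℝ (↑ω : Set (EuclideanSpace ℝ (Fin 3)))) → ∀ (z : EuclideanSpace ℝ (Fin 3)), z ≠ v → ({v, z} : Finset (EuclideanSpace ℝ (Fin 3))) ∈ K.faces → ∀ (S : Finset (Finset (EuclideanSpace ℝ (Fin 3)))), (∀ t, t ∈ S ↔ t ∈ K.faces ∧ v ∈ t ∧ z ∈ t ∧ t.card = 4) → ∑ t ∈ S, Literature.Geometry.DiscreteGeometry.ballFraction v (Literature.Geometry.DiscreteGeometry.apexWedge v (z - v) (fun w : ↥(((t).erase v).erase z) => (↑w : EuclideanSpace ℝ (Fin 3)) - v)) = 1)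
    (hGC : ∀ (K : Geometry.SimplicialComplex ℝ (EuclideanSpace ℝ (Fin 3))) (t : Finset (EuclideanSpace ℝ (Fin 3))), t ∈ K.faces → t.card = 4 → ∀ v ∈ t, Literature.Geometry.DiscreteGeometry.ballFraction v (Literature.Geometry.DiscreteGeometry.apexCone v (fun w : ↥((t).erase v) => (↑w : EuclideanSpace ℝ (Fin 3)) - v)) = (∑ z ∈ t.erase v, Literature.Geometry.DiscreteGeometry.ballFraction v (Literature.Geometry.DiscreteGeometry.apexWedge v (z - v) (fun w : ↥(((t).erase v).erase z) => (↑w : EuclideanSpace ℝ (Fin 3)) - v))) / 2 - 1 / 4)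
    (hR : ∀ (d ρ : ℝ), 0 < d → ρ ≤ 57 / 50 * d → ∀ (ω P : Finset (EuclideanSpace ℝ (Fin 3))), P ⊆ ω → (∀ a ∈ ω, ∀ b ∈ ω, a ≠ b → d ≤ dist a b) → (∀ g ∈ ω, g ∉ P → ∀ p ∈ P, ∀ q ∈ P, dist p q + ρ < dist g p) → (↑P : Set (EuclideanSpace ℝ (Fin 3))) ⊆ interior (convexHull ℝ (↑ω : Set (EuclideanSpace ℝ (Fin 3)))) → ∀ (K : Geometry.SimplicialComplex ℝ (EuclideanSpace ℝ (Fin 3))), Literature.Geometry.DiscreteGeometry.IsDelaunayTriangulation (↑ω : Set (EuclideanSpace ℝ (Fin 3))) K → ∀ (Nb : EuclideanSpace ℝ (Fin 3) → Finset (EuclideanSpace ℝ (Fin 3))), (∀ p ∈ P, ∀ z, z ∈ Nb p ↔ z ≠ p ∧ ({p, z} : Finset (EuclideanSpace ℝ (Fin 3))) ∈ K.faces) → ∀ (S : EuclideanSpace ℝ (Fin 3) → EuclideanSpace ℝ (Fin 3) → Finset (Finset (EuclideanSpace ℝ (Fin 3)))), (∀ p ∈ P, ∀ z ∈ Nb p,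 ∀ t, t ∈ S p z ↔ t ∈ K.faces ∧ p ∈ t ∧ z ∈ t ∧ t.card = 4) → ∑ p ∈ P, ∑ z ∈ Nb p, (((S p z).card : ℤ) - 5 - if ρ < dist p z then 1 else 0) ≤ 0)
    {d ρ : ℝ} (hd : 0 < d) (hρ : ρ ≤ 57 / 50 * d) (P : Finset (EuclideanSpace ℝ (Fin 3)))
    (hsep : ∀ p ∈ P, ∀ q ∈ P, p ≠ q → d ≤ dist p q) :
    (∑ p ∈ P, ((P.filter fun q => q ≠ p ∧ dist p q ≤ ρ).card : ℝ)) ≤ 12 * P.card := by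
  rcases P.eq_empty_or_nonempty with rfl | hPne
  · simp
  -- separated far frame, R := 2 Σ‖p‖ + |ρ| ≥ diam P + ρ
  obtain ⟨ω, hPω, hωsep, hfar, hPint⟩ := hframe P d (2 * ∑ p ∈ P, ‖p‖ + |ρ|) hd hsep
  have hnorm_le : ∀ p ∈ P, ‖p‖ ≤ ∑ q ∈ P, ‖q‖ := fun p hp =>
    Finset.single_le_sum (fun q _ => norm_nonneg q) hp
  have hghost2 : ∀ g ∈ ω, g ∉ P → ∀ p ∈ P, ∀ q ∈ P, dist p q + ρ < dist g p := by
    intro g hg hgP p hp q hq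
    have h1 : dist p q ≤ ‖p‖ + ‖q‖ := dist_le_norm_add_norm p q
    have h2 := hfar g hg hgP p hp
    have h3 := le_abs_self ρ
    linarith [hnorm_le p hp, hnorm_le q hq]
  have hghostP : ∀ g ∈ ω, g ∉ P → ∀ p ∈ P, ρ < dist g p ∧ d ≤ dist g p := by
    intro g hg hgP p hp
    refine ⟨?_, hωsep g hg p (hPω hp) (fun h => hgP (h ▸ hp))⟩
    have := hghost2 g hg hgP p hp p hp
    rw [dist_self] at this; linarith
  -- the sites affinely span the space
  obtain ⟨p₀, hp₀⟩ := hPne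
  have htop : affineSpan ℝ (↑ω : Set (EuclideanSpace ℝ (Fin 3))) = ⊤ :=
    interior_convexHull_nonempty_iff_affineSpan_eq_top.1 ⟨p₀, hPint (Finset.mem_coe.2 hp₀)⟩
  obtain ⟨K, hK⟩ := exists_isDelaunayTriangulation ω.finite_toSet htop
  have hfin : K.faces.Finite := hK.finite_faces ω.finite_toSet
  set Nb : EuclideanSpace ℝ (Fin 3) → Finset (EuclideanSpace ℝ (Fin 3)) := fun p =>
    ω.filter fun z => z ≠ p ∧ ({p, z} : Finset (EuclideanSpace ℝ (Fin 3))) ∈ K.faces with hNbdef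
  have hNb : ∀ p ∈ P, ∀ z, z ∈ Nb p ↔
      z ≠ p ∧ ({p, z} : Finset (EuclideanSpace ℝ (Fin 3))) ∈ K.faces := by
    intro p _ z
    simp only [hNbdef, Finset.mem_filter]
    constructor
    · exact fun h => h.2
    · intro h
      exact ⟨Finset.mem_coe.1 (hK.mem_of_mem h.2 (by simp)), h⟩
  set S : EuclideanSpace ℝ (Fin 3) → EuclideanSpace ℝ (Fin 3) → Finset (Finset (EuclideanSpace ℝ (Fin 3))) :=
    fun p z => hfin.toFinset.filter fun t => p ∈ t ∧ z ∈ t ∧ t.card = 4 with hSdef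
  have hS : ∀ p ∈ P, ∀ z ∈ Nb p, ∀ t, t ∈ S p z ↔ t ∈ K.faces ∧ p ∈ t ∧ z ∈ t ∧ t.card = 4 := by
    intro p _ z _ t
    simp only [hSdef, Finset.mem_filter, Set.Finite.mem_toFinset]
  -- the residual inequality
  have hres := hR d ρ hd hρ ω P hPω hωsep hghost2 hPint K hK Nb hNb S hS
  -- recount at each p ∈ P
  have hrec : ∀ p ∈ P, ((Nb p).card : ℤ) - 12 = ∑ z ∈ Nb p, (((S p z).card : ℤ) - 5) := by
    intro p hp
    have hpω : p ∈ ω := hPω hp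
    have hpint : p ∈ interior (convexHull ℝ (↑ω : Set (EuclideanSpace ℝ (Fin 3)))) :=
      hPint (Finset.mem_coe.2 hp)
    set Sv : Finset (Finset (EuclideanSpace ℝ (Fin 3))) :=
      hfin.toFinset.filter fun t => p ∈ t ∧ t.card = 4 with hSvdef
    have hSv : ∀ t, t ∈ Sv ↔ t ∈ K.faces ∧ p ∈ t ∧ t.card = 4 := by
      intro t; simp only [hSvdef, Finset.mem_filter, Set.Finite.mem_toFinset]
    have hfilt : ∀ z ∈ Nb p, Sv.filter (fun t => z ∈ t) = S p z := by
      intro z hz; ext t; simp only [Finset.mem_filter, hSv, hS p hp z hz]; tauto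
    have key := recount_comb Sv (Nb p) p
      (fun t => ballFraction p (apexCone p (fun w : ↥(t.erase p) => (↑w : EuclideanSpace ℝ (Fin 3)) - p)))
      (fun t z => ballFraction p (apexWedge p (z - p)
        (fun w : ↥((t.erase p).erase z) => (↑w : EuclideanSpace ℝ (Fin 3)) - p)))
      (fun t ht => ⟨((hSv t).1 ht).2.1, ((hSv t).1 ht).2.2⟩)
      (by
        intro t ht z hzt hzp
        rw [hNb p hp]
        refine ⟨hzp, K.down_closed ((hSv t).1 ht).1 ?_ (Finset.insert_nonempty _ _)⟩
        intro w hw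
        rcases Finset.mem_insert.1 hw with rfl | hw
        · exact ((hSv t).1 ht).2.1
        · rw [Finset.mem_singleton.1 hw]; exact hzt)
      (by rw [hNb p hp]; exact fun h => h.1 rfl)
      (hVF ω K hK.toIsTriangulation p hpω hpint Sv hSv)
      (by
        intro z hz
        have hz' := (hNb p hp z).1 hz
        refine hEF ω K hK.toIsTriangulation p hpω hpint z hz'.1 hz'.2 (Sv.filter fun t => z ∈ t) ?_
        intro t; simp only [Finset.mem_filter, hSv]; tauto)
      (fun t ht => hGC K t ((hSv t).1 ht).1 ((hSv t).1 ht).2.2 p ((hSv t).1 ht).2.1)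
    rw [key]
    exact Finset.sum_congr rfl fun z hz => by rw [hfilt z hz]
  -- near neighbours in K = ρ-close points of P
  have hnear : ∀ p ∈ P, (Nb p).filter (fun z => ¬ ρ < dist p z) =
      P.filter (fun q => q ≠ p ∧ dist p q ≤ ρ) := by
    intro p hp
    ext z
    simp only [Finset.mem_filter, not_lt]
    constructor
    · rintro ⟨hz, hzρ⟩
      have hz' := (hNb p hp z).1 hz
      have hzω : z ∈ ω := Finset.mem_coe.1 (hK.mem_of_mem hz'.2 (by simp))
      have hzP : z ∈ P := by
        by_contra hzP
        have := (hghostP z hzω hzP p hp).1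
        rw [dist_comm] at this
        linarith
      exact ⟨hzP, hz'.1, hzρ⟩
    · rintro ⟨hzP, hzp, hzρ⟩
      refine ⟨(hNb p hp z).2 ⟨hzp, ?_⟩, hzρ⟩
      have hρ0 : 0 ≤ ρ := dist_nonneg.trans hzρ
      refine near_pair_mem_faces hK hd.le (Finset.mem_coe.2 (hPω hp)) (Finset.mem_coe.2 (hPω hzP))
        (Ne.symm hzp) ?_ ?_
      · have h1 : dist p z ^ 2 ≤ ρ ^ 2 := pow_le_pow_left₀ dist_nonneg hzρ 2
        have h2 : ρ ^ 2 ≤ (57 / 50 * d) ^ 2 := pow_le_pow_left₀ hρ0 hρ 2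
        nlinarith
      · intro x hx hxp hxz
        have hxω : x ∈ ω := Finset.mem_coe.1 hx
        exact ⟨hωsep x hxω p (hPω hp) hxp, hωsep x hxω z (hPω hzP) hxz⟩
  -- per-vertex summation
  have hsum : ∀ p ∈ P, ∑ z ∈ Nb p, (((S p z).card : ℤ) - 5 - if ρ < dist p z then 1 else 0)
      = ((P.filter fun q => q ≠ p ∧ dist p q ≤ ρ).card : ℤ) - 12 := by
    intro p hp
    rw [Finset.sum_sub_distrib, ← hrec p hp, ← hnear p hp, Finset.sum_ite, Finset.sum_const_zero,
      add_zero, Finset.sum_const, nsmul_eq_mul, mul_one]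
    have hc := Finset.card_filter_add_card_filter_not (s := Nb p) (fun z => ρ < dist p z)
    have hc' : (((Nb p).filter (fun z => ¬ ρ < dist p z)).card : ℤ) =
        (Nb p).card - ((Nb p).filter (fun z => ρ < dist p z)).card := by
      rw [← hc]; push_cast; ring
    rw [hc']
    ring
  have htot : ∑ p ∈ P, (((P.filter fun q => q ≠ p ∧ dist p q ≤ ρ).card : ℤ) - 12) ≤ 0 := by
    calc ∑ p ∈ P, (((P.filter fun q => q ≠ p ∧ dist p q ≤ ρ).card : ℤ) - 12)
        = ∑ p ∈ P, ∑ z ∈ Nb p, (((S p z).card : ℤ) - 5 - if ρ < dist p z then 1 else 0) :=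
          Finset.sum_congr rfl fun p hp => (hsum p hp).symm
      _ ≤ 0 := hres
  have hZ : ∑ p ∈ P, ((P.filter fun q => q ≠ p ∧ dist p q ≤ ρ).card : ℤ) ≤ 12 * P.card := by
    rw [Finset.sum_sub_distrib, Finset.sum_const, nsmul_eq_mul] at htot
    linarith
  have hR' := (Int.cast_le (R := ℝ)).2 hZ
  push_cast at hR'
  exact hR'

/-- **The registered glue stub `stub_gaugeSep`** (skeleton v11): the residual on separated frames from the
tetrahedron-gauge identity and the total-cell-charge inequality. -/
theorem stub_gaugeSep : (∀ (ρ : ℝ) (ω P : Finset (EuclideanSpace ℝ (Fin 3))), P ⊆ ω → (↑P : Set (EuclideanSpace ℝ (Fin 3))) ⊆ interior (convexHull ℝ (↑ω : Set (EuclideanSpace ℝ (Fin 3)))) → ∀ (K : Geometry.SimplicialComplex ℝ (EuclideanSpace ℝ (Fin 3))), Literature.Geometry.DiscreteGeometry.IsTriangulation (↑ω : Set (EuclideanSpace ℝ (Fin 3))) K → ∀ (Nb : EuclideanSpace ℝ (Fin 3) → Finset (EuclideanSpace ℝ (Fin 3))), (∀ p ∈ P, ∀ z, z ∈ Nb p ↔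 z ≠ p ∧ ({p, z} : Finset (EuclideanSpace ℝ (Fin 3))) ∈ K.faces) → ∀ (S : EuclideanSpace ℝ (Fin 3) → EuclideanSpace ℝ (Fin 3) → Finset (Finset (EuclideanSpace ℝ (Fin 3)))), (∀ p ∈ P, ∀ z ∈ Nb p, ∀ t, t ∈ S p z ↔ t ∈ K.faces ∧ p ∈ t ∧ z ∈ t ∧ t.card = 4) → ∀ (Cells : Finset (Finset (EuclideanSpace ℝ (Fin 3)))), (∀ t, t ∈ Cells ↔ t ∈ K.faces ∧ t.card = 4) → ((∑ p ∈ P, ∑ z ∈ Nb p, (((S p z).card : ℤ) - 5 - if ρ < dist p z then 1 else 0) : ℤ) : ℝ) = ∑ t ∈ Cells, ∑ p ∈ P.filter (fun p => p ∈ t), (3 - ∑ z ∈ (t).erase p, (if ρ < dist p z then (6 : ℝ) else 5) * Literature.Geometry.DiscreteGeometry.ballFraction p (Literature.Geometry.DiscreteGeometry.apexWedge p (z - p) (fun w : ↥(((t).erase p).erase z) => (↑w : EuclideanSpace ℝ (Fin 3)) - p)))) → (∀ (d ρ : ℝ), 0 < d → ρ ≤ 57 / 50 * d → ∀ (ω P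 : Finset (EuclideanSpace ℝ (Fin 3))), P ⊆ ω → (∀ a ∈ ω, ∀ b ∈ ω, a ≠ b → d ≤ dist a b) → (∀ g ∈ ω, g ∉ P → ∀ p ∈ P, ∀ q ∈ P, dist p q + ρ < dist g p) → (↑P : Set (EuclideanSpace ℝ (Fin 3))) ⊆ interior (convexHull ℝ (↑ω : Set (EuclideanSpace ℝ (Fin 3)))) → ∀ (K : Geometry.SimplicialComplex ℝ (EuclideanSpace ℝ (Fin 3))), Literature.Geometry.DiscreteGeometry.IsDelaunayTriangulation (↑ω : Set (EuclideanSpace ℝ (Fin 3))) K → ∀ (Cells : Finset (Finset (EuclideanSpace ℝ (Fin 3)))), (∀ t, t ∈ Cells ↔ t ∈ K.faces ∧ t.card = 4) → ∑ t ∈ Cells, ∑ p ∈ P.filter (fun p => p ∈ t), (3 - ∑ z ∈ (t).erase p, (if ρ < dist p z then (6 : ℝ) else 5) * Literature.Geometry.DiscreteGeometry.ballFraction p (Literature.Geometry.DiscreteGeometry.apexWedge p (z - p) (fun w : ↥(((t).erase p).erase z) => (↑w : EuclideanSpace ℝ (Fin 3)) - p))) ≤ 0) → ∀ (d ρ : ℝ),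 0 < d → ρ ≤ 57 / 50 * d → ∀ (ω P : Finset (EuclideanSpace ℝ (Fin 3))), P ⊆ ω → (∀ a ∈ ω, ∀ b ∈ ω, a ≠ b → d ≤ dist a b) → (∀ g ∈ ω, g ∉ P → ∀ p ∈ P, ∀ q ∈ P, dist p q + ρ < dist g p) → (↑P : Set (EuclideanSpace ℝ (Fin 3))) ⊆ interior (convexHull ℝ (↑ω : Set (EuclideanSpace ℝ (Fin 3)))) → ∀ (K : Geometry.SimplicialComplex ℝ (EuclideanSpace ℝ (Fin 3))), Literature.Geometry.DiscreteGeometry.IsDelaunayTriangulation (↑ω : Set (EuclideanSpace ℝ (Fin 3))) K → ∀ (Nb : EuclideanSpace ℝ (Fin 3) → Finset (EuclideanSpace ℝ (Fin 3))), (∀ p ∈ P, ∀ z, z ∈ Nb p ↔ z ≠ p ∧ ({p, z} : Finset (EuclideanSpace ℝ (Fin 3))) ∈ K.faces) → ∀ (S : EuclideanSpace ℝ (Fin 3) → EuclideanSpace ℝ (Fin 3) → Finset (Finset (EuclideanSpace ℝ (Fin 3)))), (∀ p ∈ P, ∀ z ∈ Nb p, ∀ t, t ∈ S p z ↔ t ∈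 K.faces ∧ p ∈ t ∧ z ∈ t ∧ t.card = 4) → ∑ p ∈ P, ∑ z ∈ Nb p, (((S p z).card : ℤ) - 5 - if ρ < dist p z then 1 else 0) ≤ 0 := by
  intro hTG hCC d ρ hd hρ ω P hPω hωsep hghost hPint K hK Nb hNb S hS
  have hfin : K.faces.Finite := hK.finite_faces ω.finite_toSet
  set Cells : Finset (Finset (EuclideanSpace ℝ (Fin 3))) := hfin.toFinset.filter fun t => t.card = 4
    with hCdef
  have hCells : ∀ t, t ∈ Cells ↔ t ∈ K.faces ∧ t.card = 4 := by
    intro t; simp only [hCdef, Finset.mem_filter, Set.Finite.mem_toFinset]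
  have hG := hTG ρ ω P hPω hPint K hK.toIsTriangulation Nb hNb S hS Cells hCells
  have hC := hCC d ρ hd hρ ω P hPω hωsep hghost hPint K hK Cells hCells
  have : ((∑ p ∈ P, ∑ z ∈ Nb p, (((S p z).card : ℤ) - 5 - if ρ < dist p z then 1 else 0) : ℤ) : ℝ)
      ≤ 0 := by rw [hG]; exact hC
  exact_mod_cast this

/-- **The registered glue stub `stub_assembleSep` of line `Sketch` (skeleton v10)**: separated far frame →
solid-angle partition of unity → dihedral partition of unity → Girard → tetrahedron-gauge identity → total
cell charge `≤ 0` on separated frames → the crux `SquareWellLayerCake.AveragedTwelve`. -/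
theorem stub_assembleSep : (∀ (P : Finset (EuclideanSpace ℝ (Fin 3))) (d R : ℝ), 0 < d → (∀ p ∈ P, ∀ q ∈ P, p ≠ q → d ≤ dist p q) → ∃ ω : Finset (EuclideanSpace ℝ (Fin 3)), P ⊆ ω ∧ (∀ a ∈ ω, ∀ b ∈ ω, a ≠ b → d ≤ dist a b) ∧ (∀ g ∈ ω, g ∉ P → ∀ p ∈ P, R < dist g p) ∧ ((↑P : Set (EuclideanSpace ℝ (Fin 3))) ⊆ interior (convexHull ℝ (↑ω : Set (EuclideanSpace ℝ (Fin 3)))))) → (∀ (ω : Finset (EuclideanSpace ℝ (Fin 3))) (K : Geometry.SimplicialComplex ℝ (EuclideanSpace ℝ (Fin 3))), Literature.Geometry.DiscreteGeometry.IsTriangulation (↑ω : Set (EuclideanSpace ℝ (Fin 3))) K → ∀ v ∈ ω, v ∈ interior (convexHull ℝ (↑ω : Set (EuclideanSpace ℝ (Fin 3)))) → ∀ (S : Finset (Finset (EuclideanSpace ℝ (Fin 3)))), (∀ t, t ∈ S ↔ t ∈ K.faces ∧ v ∈ t ∧ t.card = 4) → ∑ t ∈ S, Literature.Geometry.DiscreteGeometry.ballFraction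 v (Literature.Geometry.DiscreteGeometry.apexCone v (fun w : ↥((t).erase v) => (↑w : EuclideanSpace ℝ (Fin 3)) - v)) = 1) → (∀ (ω : Finset (EuclideanSpace ℝ (Fin 3))) (K : Geometry.SimplicialComplex ℝ (EuclideanSpace ℝ (Fin 3))), Literature.Geometry.DiscreteGeometry.IsTriangulation (↑ω : Set (EuclideanSpace ℝ (Fin 3))) K → ∀ v ∈ ω, v ∈ interior (convexHull ℝ (↑ω : Set (EuclideanSpace ℝ (Fin 3)))) → ∀ (z : EuclideanSpace ℝ (Fin 3)), z ≠ v → ({v, z} : Finset (EuclideanSpace ℝ (Fin 3))) ∈ K.faces → ∀ (S : Finset (Finset (EuclideanSpace ℝ (Fin 3)))), (∀ t, t ∈ S ↔ t ∈ K.faces ∧ v ∈ t ∧ z ∈ t ∧ t.card = 4) → ∑ t ∈ S, Literature.Geometry.DiscreteGeometry.ballFraction v (Literature.Geometry.DiscreteGeometry.apexWedge v (z - v) (fun w : ↥(((t).erase v).erase z) => (↑w : EuclideanSpace ℝ (Fin 3)) - v)) = 1) → (∀ (K : Geometry.SimplicialComplex ℝ (EuclideanSpace ℝ (Fin 3)))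 (t : Finset (EuclideanSpace ℝ (Fin 3))), t ∈ K.faces → t.card = 4 → ∀ v ∈ t, Literature.Geometry.DiscreteGeometry.ballFraction v (Literature.Geometry.DiscreteGeometry.apexCone v (fun w : ↥((t).erase v) => (↑w : EuclideanSpace ℝ (Fin 3)) - v)) = (∑ z ∈ t.erase v, Literature.Geometry.DiscreteGeometry.ballFraction v (Literature.Geometry.DiscreteGeometry.apexWedge v (z - v) (fun w : ↥(((t).erase v).erase z) => (↑w : EuclideanSpace ℝ (Fin 3)) - v))) / 2 - 1 / 4) → (∀ (d ρ : ℝ), 0 < d → ρ ≤ 57 / 50 * d → ∀ (ω P : Finset (EuclideanSpace ℝ (Fin 3))), P ⊆ ω → (∀ a ∈ ω, ∀ b ∈ ω, a ≠ b → d ≤ dist a b) → (∀ g ∈ ω, g ∉ P → ∀ p ∈ P, ∀ q ∈ P, dist p q + ρ < dist g p) → (↑P : Set (EuclideanSpace ℝ (Fin 3))) ⊆ interior (convexHull ℝ (↑ω : Set (EuclideanSpace ℝ (Fin 3)))) → ∀ (K : Geometry.SimplicialComplex ℝ (EuclideanSpace ℝ (Fin 3))), Literature.Geometry.DiscreteGeometry.IsDelaunayTriangulation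 (↑ω : Set (EuclideanSpace ℝ (Fin 3))) K → ∀ (Nb : EuclideanSpace ℝ (Fin 3) → Finset (EuclideanSpace ℝ (Fin 3))), (∀ p ∈ P, ∀ z, z ∈ Nb p ↔ z ≠ p ∧ ({p, z} : Finset (EuclideanSpace ℝ (Fin 3))) ∈ K.faces) → ∀ (S : EuclideanSpace ℝ (Fin 3) → EuclideanSpace ℝ (Fin 3) → Finset (Finset (EuclideanSpace ℝ (Fin 3)))), (∀ p ∈ P, ∀ z ∈ Nb p, ∀ t, t ∈ S p z ↔ t ∈ K.faces ∧ p ∈ t ∧ z ∈ t ∧ t.card = 4) → ∑ p ∈ P, ∑ z ∈ Nb p, (((S p z).card : ℤ) - 5 - if ρ < dist p z then 1 else 0) ≤ 0) → Summit.AtomisticToContinuum.Crystallization.Theses.SquareWellLayerCake.AveragedTwelve := by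
  intro hframe hVF hEF hGC hR N x G d ρ hd hρ hsep
  have hinj : Set.InjOn x ↑G := by
    intro i hi j hj hij
    by_contra hne
    have h := hsep i (Finset.mem_coe.1 hi) j (Finset.mem_coe.1 hj) hne
    rw [hij, dist_self] at h
    linarith
  set P : Finset (EuclideanSpace ℝ (Fin 3)) := G.image x with hPdef
  have hcardP : P.card = G.card := Finset.card_image_of_injOn hinj
  have hsepP : ∀ p ∈ P, ∀ q ∈ P, p ≠ q → d ≤ dist p q := by
    intro p hp q hq hpq
    obtain ⟨i, hi, rfl⟩ := Finset.mem_image.1 hp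
    obtain ⟨j, hj, rfl⟩ := Finset.mem_image.1 hq
    exact hsep i hi j hj fun h => hpq (by rw [h])
  have hcount : ∀ i ∈ G, ((P.filter fun q => q ≠ x i ∧ dist (x i) q ≤ ρ).card) =
      (G.filter fun j => j ≠ i ∧ dist (x i) (x j) ≤ ρ).card := by
    intro i hi
    have himg : (G.filter fun j => j ≠ i ∧ dist (x i) (x j) ≤ ρ).image x =
        P.filter fun q => q ≠ x i ∧ dist (x i) q ≤ ρ := by
      rw [hPdef, Finset.filter_image]
      congr 1
      refine Finset.filter_congr fun j hj => ?_
      constructor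
      · rintro ⟨hji, hdist⟩
        exact ⟨fun h => hji (hinj (Finset.mem_coe.2 hj) (Finset.mem_coe.2 hi) h), hdist⟩
      · rintro ⟨hji, hdist⟩
        exact ⟨fun h => hji (by rw [h]), hdist⟩
    rw [← himg, Finset.card_image_of_injOn (hinj.mono (Finset.coe_subset.2 (Finset.filter_subset _ _)))]
  have hsumeq : (∑ i ∈ G, ((G.filter fun j => j ≠ i ∧ dist (x i) (x j) ≤ ρ).card : ℝ)) =
      ∑ p ∈ P, ((P.filter fun q => q ≠ p ∧ dist p q ≤ ρ).card : ℝ) := by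
    rw [hPdef, Finset.sum_image (fun i hi j hj h => hinj (Finset.mem_coe.2 hi) (Finset.mem_coe.2 hj) h)]
    refine Finset.sum_congr rfl fun i hi => ?_
    rw [← hPdef, hcount i hi]
  rw [hsumeq, ← hcardP]
  exact pointset_bound_sep hframe hVF hEF hGC hR hd hρ P hsepP

end Summit.AtomisticToContinuum.Crystallization.Theorems.ParFiveRecountAssembleSep

end
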